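import Mathlib
import HarnessLib
import HarnessLib.Audit
import Summits.Parity.Statement
import Literature.NumberTheory.Sieve.SingularSeries
import Literature.NumberTheory.Sieve.LevelOfDistribution

/-!
Route: LiouvilleShiftedTables

DORMANT since 2026-09-04T02:20:56Z (reconciler: no traction for 5 d (last activity statement-attached at 2026-08-30T01:27:31Z); parked, not closed — `ledger route dormant route-Parity-LiouvilleShiftedTables --off` to reactivate) — unstaffed, not closed; items shared with open routes are served there. `ledger route dormant <id> --off` reactivates.

# Route LiouvilleShiftedTables — Liouville is not near rank one on dilated shifted multiplication
tables — Type-II parity input for λ(p+c); with EH, HL pairs; GHL via the declared residual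

CONDITIONAL BRIDGE on the Elliott–Halberstam conjecture, carried as the CRUX ElliottHalberstam :=
Literature.NumberTheory.Sieve.LevelOfDistribution.ElliottHalberstam (the conditional_on constant, by
name; re-badge 2026-08-16, D-0027 §2.2: a bridge's open ends are cruxes; definitionally equal to the
verbatim-Mathlib item EH, over which PairsFromMAvg is stated), with the GHL-beyond-pairs sector
carried as the CRUX PairsToGHL (shared with routes RoughSemiprimeRigidity and LiouvilleMAD,
stmt-Parity-9389). Neither open end is attacked by this mechanism and neither should be staffed; the
route's own content is the PARITY ENGINE. It suffices to show X = X1 ∧ X2, the PARITY ENGINE of card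
shifted-multiplication-table-norm (gen-2, conforming re-filing of retired route
ShiftedMultiplicationTable): X1 = DilatedTableChowla — for every shift c ≠ 0 and window parameter δ
≤ 1/12, uniformly for A ∈ [x^δ, x^{1/3+δ}], the class-restricted shifted multiplication tables
M_c^{(q;u,v)} = (λ(ab+c))_{a∼A, a≡u (q); b≤x/A, b≡v (q)} have fourth moment tr(MMᵀ)² (trivially ≍
x²/q⁴) bounded by x²/(q⁴(log x)^C) on ℓ¹-average over the dilations q ≤ x^{δ/2} (Σ_q q³·max_{u,v} ≤
x²/(log x)^C; q = 1 is TableChowla, the repaired gen-1 crux: "λ on the shifted multiplication table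
is not close to a rank-one matrix"); X2 = TypeI2Dilated — λ(m+c) is equidistributed over the
bilinear moduli r·s (r ≤ x^ρ with absolute values, s ≤ x^{1/2+ρ}/r summed smoothly) intersected with
one class m−c ≡ w·(…) (mod q), on ℓ¹-average over q ≤ x^ρ (its q = 1 slice is Fouvry–Tenenbaum 2021
Thm 1.5 for f = λ). Decomposing the PRIME (Heath-Brown) and keeping λ whole, X1 is the Type-II
input, X2 the Type-I₂ input and Bombieri–Vinogradov for λ (support BVLiouville, Fouvry–Tenenbaum Thm
1.8) the Type-I input for Σ_{q≤x^{2ε}} |Σ_{n≤x, n≡h (q)} Λ(n)λ(n−h)| ≪ x/(log x)^A, which is exactly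
what turns μ ⟂ dilated shifted primes into the m ≤ x^ε-UNIFORM atom MAvg (= stmt-Parity-0613,
Bombieri's level-1 residual); ElliottHalberstam (= EH) + MAvg give Hardy–Littlewood pairs at every
fixed shift (PairsFromMAvg; both halves composed = the glue crux EngineToPairs), and PairsToGHL
carries pairs to the sub-problem Statement.
Lean: `(∀ c : ℤ, c ≠ 0 → ∀ δ : ℝ, 0 < δ → δ ≤ 1 / 12 → ∀ C : ℝ, 0 < C → ∃ x₀ : ℝ, ∀ x : ℝ, x₀ ≤ x →
∀ A : ℝ, x ^ δ ≤ A → A ≤ x ^ (1 / 3 + δ) → ∀ u v : ℕ → ℕ, (∑ q ∈ Finset.Icc 1 ⌊x ^ (δ / 2)⌋₊, (q :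
ℝ) ^ 3 * ∑ a ∈ (Finset.Ioc ⌊A⌋₊ ⌊2 * A⌋₊).filter (fun a : ℕ => a ≡ u q [MOD q]), ∑ a' ∈ (Finset.Ioc
⌊A⌋₊ ⌊2 * A⌋₊).filter (fun a' : ℕ => a' ≡ u q [MOD q]), (∑ b ∈ (Finset.Icc 1 ⌊x / A⌋₊).filter (fun b
: ℕ => b ≡ v q [MOD q]), (ArithmeticFunction.liouville (Int.toNat ((a : ℤ) * b + c)) : ℝ) *
(ArithmeticFunction.liouville (Int.toNat ((a' : ℤ) * b + c)) : ℝ)) ^ 2) ≤ x ^ 2 / Real.log x ^ C) ∧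
(∀ c : ℤ, c ≠ 0 → ∃ ρ : ℝ, 0 < ρ ∧ ∀ A : ℝ, 0 < A → ∃ C x₀ : ℝ, ∀ x : ℝ, x₀ ≤ x → ∀ w : ℕ, ∀ R S y :
ℝ, 1 ≤ R → R ≤ x ^ ρ → 0 ≤ S → S * R ≤ x ^ (1 / 2 + ρ) → 0 ≤ y → y ≤ x → (∑ q ∈ Finset.Icc 1 ⌊x ^
ρ⌋₊, ∑ r ∈ Finset.Icc 1 ⌊R⌋₊, |∑ s ∈ Finset.Icc 1 ⌊S⌋₊, ∑ n ∈ (Finset.Icc 1 ⌊y / (s * r)⌋₊).filter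
(fun n : ℕ => r * s * n ≡ w [MOD q]), (ArithmeticFunction.liouville (Int.toNat ((r : ℤ) * s * n +
c)) : ℝ)|) ≤ C * x / Real.log x ^ A)`

## Assembly
Pure logic, CRUX-ONLY (rev 9, 2026-08-16: only crux items may be hypotheses of the deciding
theorem): `closes (hD : DilatedTableChowla) (hI : TypeI2Dilated) (hE : ElliottHalberstam) (hX :
EngineToPairs) (hG : PairsToGHL) : GeneralizedHardyLittlewood := hG (hX hD hI hE)`. The glue crux
EngineToPairs (X1 → X2 → ElliottHalberstam → Hardy–Littlewood pairs at every fixed shift) is exactly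
the composition of the two support halves SieveToMAvg (X1 ∧ X2 ∧ BVLiouville ⟹ MAvg; BVLiouville is
PROVED in tree) and PairsFromMAvg (EH ∧ MAvg ⟹ PairsHL; EH ↔ ElliottHalberstam is `Iff.rfl`): `fun
hD hI hE => hP hE (hS hD hI hB)` (lean-checked); the crux PairsToGHL (the declared GHL-beyond-pairs
sector) carries pairs to the sub-problem Statement. TableChowla (the q = 1 slice of
DilatedTableChowla, which conversely pays for X1's whole Siegel range q ≤ (log x)^K by positivity
and feeds hD through the glue support TableToDilated : TableChowla → LargeDilatedTableChowla →
DilatedTableChowla, filed 2026-08-16 with the band statement LargeDilatedTableChowla), EH,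
BVLiouville, MAvg, SieveToMAvg, PairsFromMAvg, PairsHL and Assembly are items but not hypotheses of
`closes`. So X ∧ BVLiouville ⟹ MAvg (the parity half) UNCONDITIONALLY; X ∧ ElliottHalberstam ⟹
Hardy–Littlewood pairs at every fixed shift; GHL beyond pairs is the crux PairsToGHL, listed, not
attacked.

CONDITIONAL on Literature.NumberTheory.Sieve.LevelOfDistribution.ElliottHalberstam — this route is an explicit reduction to that named conjecture (D-0019: crux floor waived).

Rationale: WHY THIS LINE. Harman2007 §14.2 (p.286) and Polymath8b2014 §8 locate the whole difficulty of μ/λ at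
p+2 in ONE missing input — Type-II (bilinear) information for the shifted primes — and Ford–Maynard
(FordMaynard2024PrimeSieves) prove some Type-II window is necessary; the card's move: decompose the
prime (Heathbrown1982) and keep λ whole — the architecture of Pitt's cusp-form Titchmarsh theorem
(Pitt2012, where GL(2) supplies the bilinear bound through the spectral large sieve) — so that the
parity-breaking bilinear object Σ α_a β_b λ(ab+c) has no main term and no singular series, and to
identify the needed bound with an operator norm, hence (‖M‖⁴_op ≤ tr(MMᵀ)²) with Liouville
cancellation on the rank-one 4-point pattern {ab+c, a'b+c, ab'+c, a'b'+c}, a fixed point of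
Cauchy–Schwarz that is trivial exactly at c = 0. New in gen-2, forced by writing the assembly to the
Statement: the terminal parity atom that EH can use is Bombieri's level-1 residual MAvg, an
ℓ¹-average over DILATIONS m ≤ x^ε, so the engine must be uniform over sub-progression tables mod q ≤
x^ε — filed as ℓ¹-averages over q (DilatedTableChowla, TypeI2Dilated) and NOT pointwise in q,
because class-restricted tables whose modulus is a multiple of a Siegel-exceptional q₁ have no
cancellation in the λ ≈ χ₁ world (pointwise-in-q versions are Landau–Siegel-hard, cf. Tao–Teräväinen
arXiv:2109.06291), while in the ℓ¹-average the multiples of q₁ > (log x)^{C+2} cost only x²(log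
x)/q₁ and smaller q₁ are excluded by Siegel's theorem — the Bombieri–Vinogradov division of labour.
Imported: operator-norm/fourth-moment bookkeeping (linear algebra), the dispersion method for the
Type-I₂ corner (BombieriFriedlanderIwaniecActa1986 Thm 9; DrappeauTopacogullari2019 and
FouvryTenenbaum2021 Thm 1.5, which settles the q = 1 slice for λ), Bombieri's asymptotic sieve
(BombieriAsymptoticSieve1976) for the Elliott–Halberstam step, and — as the intended ENGINE for X1,
not a hypothesis — q-aspect Matomäki–Radziwiłł technology (MatomakiRadziwillTao2015,
doi:10.1112/plms.12546) on the rank-one family (modulus aa', residue ac, shift (a'−a)c). Relative to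
the negatives index: TableChowla inserts `δ ≤ 1/12` (the refutation of stmt-Parity-4218 used δ = 1,
A = x, B = 1); relative to the retired gen-1 route the assembly reaches the Statement (MAvg →
PairsHL under EH → PairsToGHL), BVLiouville is re-filed non-vacuously (4220 was vacuous: residue
condition at d = 0), and Type I₂ is cited to Fouvry–Tenenbaum.

RANKED CRUXES. #2 TableChowla (crux) — Card Crux 1, repaired (q = 1 table, log-power form): for
every c ≠ 0, 0 < δ ≤ 1/12, C > 0 and all large x, uniformly for x^δ ≤ A ≤ x^{1/3+δ}: Σ_{a,a' ∈
(A,2A]} (Σ_{b ≤ x/A} λ(ab+c)λ(a'b+c))² ≤ x²/(log x)^C (trivial ≍ x²; diagonal a = a' ≍ x²/A ≤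
x^{2−δ}; random model ≍ xA ≤ x^{17/12}). Equivalently tr(M_cM_cᵀ)² ≤ A²B²(log x)^{-C}, B = x/A ≥
x^{7/12}; multiplying by λ(a)λ(a'): two-point Chowla Σ_{m ≡ 0 (aa'), m ≤ aa'B} λ(m+ac)λ(m+a'c) small
on average over (a,a'). The most informative node: implied by DilatedTableChowla (its q = 1 term)
and the natural first target for provers and refuters; it FEEDS `closes` through the glue support
TableToDilated (TableChowla → LargeDilatedTableChowla → DilatedTableChowla, unused-crux repair
2026-08-16): by positivity the q = 1 table pays for the whole Siegel range q ≤ (log x)^K of X1,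
classes included. [difficulty: open-problem] (why it might fail: Needs a (log x)^{-C} ∀C saving in
2-point Chowla averaged over the rank-one family (modulus aa', residue ac, shift (a'−a)c) of density
A⁻² among (q,r); q-aspect MR (KMT) is 1-point, almost-all q, ε-savings; for A > x^{1/3} each
progression is shorter than its modulus.) [MatomakiRadziwillTao2015, doi:10.1112/plms.12546,
Harman2007, Polymath8b2014, Pitt2012, Literature.Barriers.Parity.Polymath2014_liouvillePairAP]
#3 DilatedTableChowla (crux) — X1. For every c ≠ 0, 0 < δ ≤ 1/12, C > 0 and all large x, uniformly
for x^δ ≤ A ≤ x^{1/3+δ} and for every choice of classes u(q), v(q): Σ_{q ≤ x^{δ/2}} q³ · Σ_{a,a' ∈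
(A,2A], a≡a'≡u(q) (mod q)} (Σ_{b ≤ x/A, b ≡ v(q) (mod q)} λ(ab+c)λ(a'b+c))² ≤ x²/(log x)^C.
Normalisation: each (q,u,v)-term is trivially ≍ x²/q⁴ (classes of a ∼ A contain no small elements
since q ≤ x^{δ/2} ≤ A^{1/2}; diagonal ≍ x²/(q³A)), so the left side is trivially ≍ x² log x and the
claim is a (log x)^{C+1} saving on log-average over dilations, with a sup over classes. This is what
the sieve glue consumes: for (w,q) = 1 the class-restricted bilinear form Σ_{ab≡w (q)} α_aβ_bλ(ab+c)
is block-diagonal over u ∈ (ℤ/q)ˣ with blocks M^{(q;u,wu⁻¹)}, so |·| ≤ ‖α‖‖β‖ max_u ‖block‖_op ≤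
‖α‖‖β‖ (max_{u,v} F(q,u,v))^{1/4}, and Hölder over q against Σ_q q³F ≤ x²/(log x)^C gives the
1/q-proportional Type-II saving that MAvg needs. Reduction filed (support): X1 ⇐ TableChowla ∧
LargeDilatedTableChowla via TableToDilated — block fourth moments are monotone under restriction, so
every term q ≤ (log x)^K is dominated by the q = 1 table and only the band (log x)^K < q ≤ x^{δ/2}
is q-aspect content. (The ℓ¹ form is deliberately the MR-provable one: multiples of a
Siegel-exceptional q₁ cost ≤ x² log x/q₁, see WHY THIS LINE.) [deps: TableChowla] [difficulty:
open-problem] (why it might fail: Adds a sup over classes mod q and dilations up to x^{δ/2} to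
TableChowla: an MR-type proof must exclude multiples of exceptional q₁ ≤ (log x)^{C+2} via Siegel as
BV does, no q-aspect 2-point MR theorem exists, and one structured bad class (u,v) per q breaks the
sup.) [MatomakiRadziwillTao2015, doi:10.1112/plms.12546, Vatwani2016, Harman2007,
IwaniecKowalski2004, arXiv:2109.06291]
#9 LargeDilatedTableChowla (support; filed 2026-08-16 by the unused-crux repair = the foreseen
layer-2 piece GenericDilations) — X1 with the Siegel range removed: for every c ≠ 0, δ ≤ 1/12, C
there are K, x₀ with Σ_{(log x)^K < q ≤ x^{δ/2}} q³ · Σ_{a≡a'≡u(q)} (Σ_{b≡v(q)} λ(ab+c)λ(a'b+c))² ≤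
x²/(log x)^C uniformly in A ∈ [x^δ, x^{1/3+δ}] and in the classes (∃K: the weakest threshold the
glue accepts); implied by X1 (sub-sum), it is the genuinely q-aspect content of X1 and is not
staffed separately while X1 is. [difficulty: open-problem]
#9 TableToDilated (support; glue, provable now) — TableChowla → LargeDilatedTableChowla →
DilatedTableChowla: for every q and ALL subsets U, V of the index ranges, Σ_{a,a'∈U}(Σ_{b∈V}
λ(ab+c)λ(a'b+c))² = Σ_{b,b'∈V}(Σ_{a∈U} λ(ab+c)λ(ab'+c))² ≤ the full TableChowla sum (drop
non-negative squares twice), so Σ_{q ≤ (log x)^K} q³F(q,u,v) ≤ (log x)^{4K}·x²/(log x)^{C+1+4K}; add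
the band from LargeDilatedTableChowla at exponent C+1 and use 2 ≤ log x. This is how the rank-2 crux
feeds `closes`. [difficulty: M]
#4 TypeI2Dilated (crux) — X2 (Type I₂ for λ with bilinear moduli, one class constraint on the
product, ℓ¹ over dilations). For every c ≠ 0 there is ρ > 0 such that for every A and all large x,
for every class w and all 1 ≤ R ≤ x^ρ, S ≥ 0 with SR ≤ x^{1/2+ρ}, 0 ≤ y ≤ x: Σ_{q ≤ x^ρ} Σ_{r ≤ R}
|Σ_{s ≤ S} Σ_{n ≤ y/(sr), rsn ≡ w (mod q)} λ(rsn+c)| ≤ C x/(log x)^A (trivially ≍ x log³x). The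
inner double sum is λ over the progression c mod rs (∩ the class w+c mod q) with the
truncated-divisor multiplicity of (m−c)/r, i.e. the Titchmarsh-divisor shape. The q = 1 slice is IN
PRINT (Fouvry–Tenenbaum 2021 Thm 1.5 with f = λ ∈ 𝓕(1,1): R ≤ x^{1/105−ε}, QR ≤ x/ℒ^B, fixed residue
1 ≤ |a| ≤ ℒ^A, see NUMBERS) after removing the coprimality conditions (c fixed: finitely many gcd
patterns) and the (1/φ)Σλ main terms (PNT for λ); q ≤ (log x)^B also follows (f = λχ ∈ 𝓕(q,1), loss
D^{C₀}). Open content: (log x)^B < q ≤ x^ρ, where the residue mod lcm(rs,q) depends on s through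
CRT. For SR ≤ x^{1/2−ε} everything is Bombieri–Vinogradov for λ. In the glue (R,S,y) are constants
(dyadic ranges by differencing, log weights by partial summation in y and S, γ_r-coefficients by
Cauchy–Schwarz against the trivial bound x log/(rq)). [difficulty: L] (why it might fail: q = 1 is
Fouvry–Tenenbaum Thm 1.5 (R ≤ x^{1/105}); the dilation range (log x)^B < q ≤ x^ρ carries s-dependent
CRT residues mod lcm(rs,q), outside the fixed-residue dispersion of BFI Thm 9 / F–T (whose D^{C₀}
loss is polynomial in q) — a new large-sieve-in-q step is needed.) [FouvryTenenbaum2021,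
doi:10.1090/tran/8442, BombieriFriedlanderIwaniecActa1986, DrappeauTopacogullari2019,
FouvryRadziwill2022, Literature.NumberTheory.Sieve.BombieriFriedlanderIwaniecTheorem5Star]
#9 BVLiouville (support; PROVED — Cruxes.TypeI2Dilated.PeelToDrappeau.stub_bvLiouville @
7013b04e1aff) — Bombieri–Vinogradov for λ at level x^{1/2−ε} with absolute values, one residue c_d ∈
[0,d) and one height y_d ≤ x per modulus d ≥ 1: Σ_{d ≤ x^{1/2−ε}} |Σ_{n ≤ y_d/d} λ(dn + c_d)| ≤ C
x/(log x)^A (Fouvry–Tenenbaum 2021 Thm 1.8, f = λ). Residue condition only for d ≥ 1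
(stmt-Parity-4220 imposed it at d = 0 and was vacuous). [difficulty: L] [FouvryTenenbaum2021,
IwaniecKowalski2004, Vaughan1980, BombieriFriedlanderIwaniecActa1986]
#9 MAvg (support) — Terminal parity node = stmt-Parity-0613
(MobiusShiftedPrimes.MobiusDilatedShiftedPrimesAvg, shared by signature): for every h ≥ 1 there is ε
> 0 with Σ_{m ≤ x^ε} log m · |Σ_{d ≤ x/m} μ(d)Λ(dm+h)| = o(x) — Bombieri's level-1 asymptotic-sieve
residual for a_n = Λ(n+h) (trivial ≍ ε²x(log x)²/2: a uniform (log x)^{2+δ}/m saving over dilations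
m ≤ x^ε is needed). Not attacked directly: SieveToMAvg delivers it from X1 ∧ X2 ∧ BVLiouville; filed
so that a proof or refutation of 0613 moves this route too. [difficulty: open-problem]
[BombieriAsymptoticSieve1976, Harman2007, Vatwani2016, MurtyVatwani2017, Lichtman2020]
#9 SieveToMAvg (support; the first half of EngineToPairs) — the sieve glue (sizable but standard):
DilatedTableChowla → TypeI2Dilated → BVLiouville → MAvg. Plan (all parameters in the item text): c
:= −h, ρ from X2, δ₁ := ρ/4, ε := δ₁/8; (i) μ(d) = λ(d)Σ_{k²∣d}μ(k) and complete multiplicativity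
reduce MAvg to Σ_{q≤X^{2ε}} |Σ_{n≤X, n≡h (q)} Λ(n)λ(n−h)| ≪ X/(log X)^6; (ii) Heath-Brown's identity
(K₀ = 3, in tree) with a q-uniform classification: a sub-product in [X^{δ₁}, X^{1/3+δ₁}] ∪
[X^{2/3−δ₁}, X^{1−δ₁}] ⇒ Type II, a smooth variable ≥ X^{1/2+2δ₁} ⇒ Type I, two smooth variables in
(X^{1/2−3δ₁}, X^{1/2+2δ₁}] ⇒ Type I₂; (iii) Type II from X1 through the class blocks (u, hu⁻¹) and
Hölder over q; (iv) Type I from BVLiouville (moduli dq' ≤ X^{1/2−2δ₁+2ε}); (v) Type I₂ from X2 by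
Cauchy–Schwarz against the trivial bound. Constants Siegel-ineffective. [difficulty: XL]
[Heathbrown1982, Harman2007, BombieriFriedlanderIwaniecActa1986, FordMaynard2024PrimeSieves,
IwaniecKowalski2004]
#5 ElliottHalberstam (crux; DECLARED BRIDGE hypothesis = conditional_on; conjecture-grade, not for
provers; its verbatim-Mathlib duplicate #9 EH = stmt-Parity-11314, auto-crux, `Iff.rfl`, is the
input of PairsFromMAvg and shared with RoughSemiprimeRigidity/LiouvilleMAD — vet once) — the
Elliott–Halberstam conjecture BY NAME,
`Literature.NumberTheory.Sieve.LevelOfDistribution.ElliottHalberstam` (∀ θ < 1, level x^θ; added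
2026-08-16, D-0027 §2.2). Used once, at θ = 1 − ε₀/2 in PairsFromMAvg (BV does not suffice).
[difficulty: open-problem] (why it might fail: open for all θ > 1/2; FALSE at the endpoint,
FriedlanderGranville1989; beyond 1/2 only for well-factorable weights, BFI Thm 10 /
Maynard2020LargeModuliII, unusable with μ-coefficients; must pass the large-sieve 1/2 barrier.)
[ElliottHalberstam1970, Polymath8b2014, FriedlanderGranville1989,
BombieriFriedlanderIwaniecActa1986, Maynard2020LargeModuliII,
Literature.Barriers.Parity.LargeSieveLevelHalf]

#9 PairsHL (support) — Hardy–Littlewood pairs, Λ-form, fixed shift: for every h ≥ 1, Σ_{n≤N}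
Λ(n)Λ(n+h) = 𝔖({0,h})·N + o(N). = stmt-Parity-9387 (shared with RoughSemiprimeRigidity): the
terminal statement of the engine + bridge (k-tuples and shift-uniform GHL sit in the crux
PairsToGHL). Not a hypothesis of `closes` (PairsFromMAvg concludes it). [difficulty: open-problem]
[HardyLittlewood1923, GreenTao2010]
#9 PairsFromMAvg (support; the second half of EngineToPairs) — Bombieri's asymptotic sieve at level
1 for a_n = Λ(n+h), all shifts: EH → MAvg → PairsHL (provable bookkeeping; the m ≤ N^{ε₀} part is
the MAvg expression, the rest is EH at θ = 1−ε₀/2 plus the main-term computation −Σ_{(d,h)=1} μ(d)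
log d/φ(d) = 𝔖({0,h}) — in full in the item text; needs the ordered Euler product
Literature.NumberTheory.Sieve.singularSeries identified with G_h(0)). [difficulty: L]
[BombieriAsymptoticSieve1976, Bombieri1976, MurtyVatwani2017, Vatwani2016, HardyLittlewood1923]
#6 PairsToGHL (crux; DECLARED OPEN END = the GHL-beyond-pairs sector, conjecture-grade, not for
provers; support→crux 2026-08-16, D-0027 §2.2(b); stmt-Parity-9389, shared with
RoughSemiprimeRigidity, LiouvilleMAD) — fixed-shift Hardy–Littlewood pairs (PairsHL inlined) →
GeneralizedHardyLittlewood (Green–Tao Conj. 1.2, all d, t, L, convex K). Contains prime k-tuples for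
k ≥ 3 (a k-fold engine would need multilinear parity atoms μ ⟂ Π_{i<k}Λ(dm+c_i) AND 'tuple-EH'),
general slopes, shift-uniformity |b_i| ≤ LN (Landau–Siegel-hard: MatomakiMerikoski2023 Thm 1.3) and
the fibration d ≥ 2 ⇐ d = 1 (route DicksonFibration, provable). True iff GHL given pairs; unprovable
by anything here. [difficulty: open-problem] (why it might fail: nothing derives k ≥ 3 tuples,
general slopes or shift-uniform pairs from fixed-shift pairs — uniformity alone forces Siegel-zero
repulsion; GHL-minus-pairs, a declared open end, not a lemma.) [GreenTao2010, MatomakiMerikoski2023,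
GoldstonSuriajaya2021, HardyLittlewood1923]

#6 EngineToPairs (crux; ONE-PIECE GLUE for the crux-only `closes` rule, 2026-08-16,
stmt-Parity-14659) — DilatedTableChowla → TypeI2Dilated → ElliottHalberstam → PairsHL = the
composition of the support halves SieveToMAvg and PairsFromMAvg with the proved BVLiouville (`fun hD
hI hE => hP hE (hS hD hI hB)`, lean-checked): prove the halves and compose, or directly. [deps:
SieveToMAvg, PairsFromMAvg] [difficulty: XL] (why it might fail: false as stated if the Heath-Brown
casework leaves a piece uncovered for some ρ admissible in TypeI2Dilated, or if singularSeries {0,h}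
is not the constant Bombieri's main term yields.) [Heathbrown1982, Harman2007,
BombieriAsymptoticSieve1976, FordMaynard2024PrimeSieves]

TWO-LAYER PLAN. Glued splits (k ≤ 3, depth 1). FILED 2026-08-16 (as support items, unused-crux
repair): DilatedTableChowla ⇐ TableChowla → LargeDilatedTableChowla → DilatedTableChowla (glue
TableToDilated; the once-foreseen middle piece SmallDilations, q ≤ (log x)^B with its sup over
classes, is free — block fourth moments are monotone under restriction); the formal `--split
DilatedTableChowla` over these two pieces (or re-badging LargeDilatedTableChowla crux, rank 3) is
the tenure move once TableChowla closes, which stays top-level and splittable until then. Foreseen,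
filed only when a crux closes or stalls: TableChowla ⇐ PretentiousPairs (pairs (a,a') and scales
where λ restricted to ac mod aa' is exceptional in the KMT sense: Halász/large-sieve count) →
GenericPairs (q-aspect Matomäki–Radziwiłł on the rank-one family with a log-power saving) →
TableChowla; TypeI2Dilated ⇐ UndilatedFT (q = 1: vendor Fouvry–Tenenbaum Thm 1.5 for λ, discharge
coprimality) → DilationLargeSieve ((log x)^B < q ≤ x^ρ) → TypeI2Dilated; SieveToMAvg ⇐
HeathBrownCasework → TypeIITreatment → SieveToMAvg.

KILL CRITERIA. TableChowla REFUTED for some (c, δ ≤ 1/12, C) by a structured lower bound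
tr(M_cM_cᵀ)² ≫ x²/(log x)^{C₀} from an unforeseen algebraic family of pairs (a,a') closes the route
(close refuted:TableChowla; DilatedTableChowla dies with it) unless the witness only kills the ∀C
form, in which case restate both table cruxes with the fixed exponent the glue actually uses (C₀ of
order 40 + 4·6, by `workitem add`). DilatedTableChowla refuted with TableChowla intact ⇒ by
TableToDilated the witness is a dilation band q > (log x)^K (¬LargeDilatedTableChowla; a bad class
or band) ⇒ pivot: restate LargeDilatedTableChowla and X1 with the exceptional set of q removed
explicitly (ℓ¹ over q₁-free q) — the sieve glue tolerates any exceptional set E with Σ_{q∈E} 1/q ≤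
(log x)^{-C}. TypeI2Dilated refuted in the dilation range ⇒ same pivot (its q = 1 slice is a
theorem). EngineToPairs refuted (coverage gap / constant mismatch) ⇒ restate with corrected
parameters (pivot, not death). MAvg (0613) refuted ⇒ this route, and every M_avg-based line, is dead
at the terminal node: close refuted. PairsHL refuted ⇒ GHL is false (the summit closes negatively
through any route). ElliottHalberstam refuted ⇒ the bridge retires, not the engine (X ∧ BVLiouville
⟹ MAvg stays as the unconditional parity half; re-file under an EH-free pairs assembly if one
appears); PairsToGHL refuted ⇒ GHL is false. Route MOOT (close superseded) if MAvg is proved by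
other means.

NOT DECOMPOSED YET. The o(1) (card) form of the table statement as a stepping stone (it does not
suffice: Heath-Brown/Harman coefficients cost fixed log powers); the balanced window A ∈ [x^{1/3},
x^{1/2}] (alternative to Type I₂; a different route); the exact exponent C₀ the glue needs (layer 2,
after a refuter forces it); vendoring Fouvry–Tenenbaum Thm 1.5/1.8 and BFI Thms 6/7*/9 as Literature
facts (below); the k-tuple engine (μ ⟂ Π Λ(dm+c_i): k−1 primes decomposed at once — not attempted)
and everything inside PairsToGHL (tuples, slopes, shift-uniformity, fibration — owned by
DicksonFibration / HyperbolicConstellations / PrimeDeterminantCells); effective constants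
(Siegel-ineffective).

CHEAPEST FALSIFIER. (i) Logic, one page: does TableChowla (log-power, A = x^{1/3}) imply binary
Chowla Σ_{n≤x} λ(n)λ(n+1) = o(x) by a short argument? If yes the crux is not easier than Chowla and
the route is a 'reformulation' (gen-1 triage refuter: no — one residue ac per modulus aa', logically
incomparable). (ii) Numerics (kit): s₁(M_c)/(√A+√B) for A = x^{0.3}, B = x/A, x = 10⁶…10⁸, c ∈ {±1,
2}, and for the class-restricted blocks with q ∈ {3, 8, 30}: the square-root-laws card measured
0.97–1.00 for q = 1 (NUMBERS) — an upward drift like (AB)^η, or a block ratio growing with q, warns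
(numerics cannot see log powers). (iii) Lookup, done at open: the undilated Type I₂ for λ IS in
print (Fouvry–Tenenbaum 2021 Thm 1.5, R ≤ x^{1/105−ε}, QR ≤ x/ℒ^B) — so the route's open content is
honestly X1 plus the dilation range of X2; a refuter who also finds the dilation range in print
(Fouvry–Radziwiłł unbalanced convolutions, Drappeau's dispersion papers, Assing–Blomer–Li uniform
Titchmarsh) should downgrade TypeI2Dilated to support — two engine cruxes (TableChowla,
DilatedTableChowla) remain.

NUMBERS. Type-I level for λ: 1/2 (Fouvry–Tenenbaum Thm 1.8: Q ≤ √x/ℒ^B, loss D^{C₀}). Type I₂ for λ,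
q = 1 (Fouvry–Tenenbaum Thm 1.5): R ≤ x^{1/105−ε}, QR ≤ x/ℒ^B, 1 ≤ |a| ≤ ℒ^A (hal-03167173 pp.7–8);
BFI 1986 Thm 9 (Λ): R < x^{1/10−ε}, QR < x(log x)^{-B}; Fouvry–Radziwiłł: Σ_{Q<q≤2Q}|Δ_f(x;q,a)| ≪
x/ℒ^{1−ε} for Q ≤ x^{17/33−ε} (too weak for us). Window: δ ≤ 1/12, A ∈ [x^δ, x^{5/12}], B = x/A ≥
x^{7/12}, dilations q ≤ x^{δ/2} ≤ A^{1/2}; glue parameters δ₁ = ρ/4, ε = δ₁/8, K = (log x)⁴, q ≤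
K²x^ε ≤ x^{2ε}. Ford–Maynard: (γ,θ,ν) = (1/2−ε, δ, 1/3) ⇒ C⁻ = 0 without Type I₂
(FordMaynard2024PrimeSieves Thm 4.16): X2 is load-bearing. Numerics (card
square-root-laws-parity-objects, x ≤ 2·10⁶): s₁(λ-table)/(√A+√B) ∈ [0.97, 1.00] at (A,B,c) ∈
{(300,300,1),(40,12000,1),(25,18000,1),(90,5000,−7)} (Bai–Yin edge). Items: 15 (cruxes: 3 engine +
EngineToPairs + 2 open ends + duplicate EH; 7 support incl. LargeDilatedTableChowla and the glue
TableToDilated; 1 assembly).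

DEFINITION REQUESTS. None for Lean notions (all constants are Mathlib +
Literature.NumberTheory.Sieve.singularSeries + the EH constant). Cite facts wanted (cite items,
grounder/tenure pass): Fouvry–Tenenbaum 2021 Thm 1.5/1.8 for f = λ (FouvryTenenbaum2021 =
doi:10.1090/tran/8442); Drappeau–Topacogullari 2019 Thm 1.2/1.3 (DrappeauTopacogullari2019); BFI
1986 Thms 6, 7*, 9 (BombieriFriedlanderIwaniecActa1986 §16; the tree vendors 0(b), 1, 2, 5, 5*, 10
only).

Novelty: Searches (2026-08-15, this planner; `lit search` (searchd) and OpenAlex/S2 timed out rc 75 during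
the session, recorded as not consulted; galaxy worked): `lit galaxy search "Liouville function
shifted primes" --star all` (0/0/0); `lit galaxy search "Titchmarsh divisor problem" --star all`
(panama 9 books incl. Cojocaru–Murty, pdf 10 incl. hal-03167173 = Fouvry–Tenenbaum READ pp.1–12,
arXiv:2005.13915 Assing–Blomer–Li 'Uniform Titchmarsh divisor problems', arXiv:2003.02201
Drappeau–Fiorilli); `ledger negatives --problem Parity` (2 rows: stmt-Parity-4218 = the gen-1 crux,
misstated δ-window; stmt-Parity-9541 unrelated); in-tree reads of every GHL route file (24) and both
Theorems refutations; bib grep (DrappeauTopacogullari2019, Pitt2012, FouvryRadziwill2022,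
KlurmanMangerelTeravainen2023 present; FouvryTenenbaum2021 fetched via `lit cite
10.1090/tran/8442`); plus the card's searches (lit search local/zbmath/crossref: 'Liouville shifted
products bilinear' 0, 'averaged Chowla dilations' → arXiv:1708.02610, 'Chowla conjecture arithmetic
progressions average moduli' → arXiv:1710.01195, arXiv:2304.05344, 'Multiplicative functions in
short arithmetic progressions' → doi:10.1112/plms.12546, lit frontier Parity --since 2020, lit
bridges Parity --cross any) and the gen-1 route's (crossref: Titchmarsh divisor problem
multiplicative functions → doi:10.2140/ant.2019.13.2383 READ; Pitt →
doi:10.1090/s0894-0347-2012-00750-4; Möbius in APs large moduli → doi:10.1090/memo/1542 READ; galaxy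
'm  [refs: 10.1090/tran/8442`, 10.1112/plms.12546, 10.2140/ant.2019.13.2383, 10.1090/s0894-0347-2012-00750-4, 10.1090/memo/1542, 10.1090/tran/8442, 2005.13915, 2003.02201, 1708.02610, 1710.01195, 2304.05344, doi:10.1112/plms.12546, doi:10.2140/ant.2019.13.2383, doi:10.1090/s0894-0347-2012-00750-4, doi:10.1090/memo/1542, doi:10.1090/tran/8442, DrappeauTopacogullari2019, Pitt2012, FouvryRadziwill2022, KlurmanM]

Barriers (technique_class: type-II bilinear-forms dispersion operator-norm): - technique_class: type-II bilinear-forms dispersion operator-norm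
- Literature.Barriers.Parity.FordMaynardMinimalTypeII: respected, not evaded — the route SUPPLIES a
Type-II window [x^δ, x^{1/3+δ}] (the table cruxes) precisely because some window is necessary at
Type-I level < 1; a_n = λ(n+c) is signed, so the relevant half is FM's asymptotic form, met by
adding Type I₂.
- Literature.Barriers.Parity.FordMaynardLowLevel: with BV only (γ = 1/2−ε) and Type II on [δ,
1/3+δ], (γ,θ,ν) has γ ∉ [θ,θ+ν] and γ < 1−θ−ν, so C⁻ = 0 and Type I/II alone cannot close; the route
exits through TypeI2Dilated (trilinear information FM §4.6 list as outside their setup) — which is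
why X2 is a crux and not glue.
- Literature.Barriers.Parity.SelbergParityBarrier: Type-I data of any level leave Σ_p λ(p+c)
undetermined (Bombieri's indeterminacy, = why MAvg is the level-1 residual); the route's decisive
input is bilinear and parity-SENSITIVE (it fails for Selberg's ghost 1+λ and for small-conductor
pretenders χ, whose class-restricted tables are constant), so the barrier's technique class is not
the route's.
- Literature.Barriers.Parity.PrimePairParity: inserting ω = 1 − λ(n)λ(n+2) destroys the product
structure λ(ab+c) (ω is not a function of ab+c), so the deduction is not weight-insertion invariant;
it is an instance of the 'bilinear expressions' exit Polymath name.
- Literature.Barriers.Parity.MatomakiRadziwillTao2015_counterexample: the needed averaged Chowla is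
for λ, non-pretentious uniformly in

History (route lifecycle, newest last):
- 2026-08-16T02:19:16Z · AUTO-CRUX: 1 conjecture-grade item(s) promoted to crux (EH) — refuter vetting / tiering apply (operator:999:1362873)
- 2026-08-16T04:26:53Z · rev 10: restated Assembly (stmt-Parity-14276) — route-repair (rbadge): restate the (optional, documentary) Assembly item 1:1 so that it is again the type of the re-certified crux-only `closes` (rev 9): Dilate (planner-rbadge-Parity-LiouvilleShiftedTables-1b91623b-0)
- 2026-08-24T20:41:55Z · DORMANT — reconciler: no traction for 7.1 d (last activity statement-attached at 2026-08-17T18:44:29Z); parked, not closed — `ledger route dormant route-Parity-LiouvilleS (operator:999:1719014)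
- 2026-08-28T19:20:20Z · REACTIVATED — reconciler: reactivated — activity item-evidence-added at 2026-08-28T17:02:41Z after parking at 2026-08-24T20:41:55Z (operator:999:2247164)
- 2026-09-04T02:20:56Z · DORMANT — reconciler: no traction for 5 d (last activity statement-attached at 2026-08-30T01:27:31Z); parked, not closed — `ledger route dormant route-Parity-LiouvilleShi (operator:999:2551401)

sub-problem: GeneralizedHardyLittlewood · status: dormant · opened planner-plancard-Parity-GeneralizedHardyLittl-d0e737d2-g2-0 2026-08-15T19:07:04Z · rev 14 · ledger route-Parity-LiouvilleShiftedTables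
GENERATED by the gate from the ledger (D-0016/17). Provers cite these decls: `theorem foo : Summit.Parity.GeneralizedHardyLittlewood.Theses.LiouvilleShiftedTables.<Decl> := …` in Summits/Parity/GeneralizedHardyLittlewood/Theorems/<Name>.lean.
-/

namespace Summit.Parity.GeneralizedHardyLittlewood.Theses.LiouvilleShiftedTables

open scoped BigOperators Topology Manifold Classical MeasureTheory ProbabilityTheory Matrix InnerProductSpace ComplexConjugate ContinuousMap
open Filter Set Function TopologicalSpace MeasureTheory

attribute [summit_statement] _root_.GeneralizedHardyLittlewood
attribute [route_premise "route-Parity-LiouvilleShiftedTables"] _root_.Literature.NumberTheory.Sieve.LevelOfDistribution.ElliottHalberstam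

/-- item stmt-Parity-14270 · crux · rank 2 · open · by planner
why it might fail: Needs a (log x)^{-C} ∀C saving in 2-point Chowla averaged over the rank-one family (modulus aa', residue ac, shift (a'−a)c) of density A⁻² among (q,r); q-aspect MR (KMT) is 1-point, almost-all q, ε-savings; for A > x^{1/3} each progression is shorter than its modulus.
sources: MatomakiRadziwillTao2015, doi:10.1112/plms.12546, Harman2007, Polymath8b2014, Pitt2012, Literature.Barriers.Parity.Polymath2014_liouvillePairAP
[crux] Card Crux 1, repaired (q = 1 table, log-power form): for every c ≠ 0, 0 < δ ≤ 1/12, C > 0 and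
all large x, uniformly for x^δ ≤ A ≤ x^{1/3+δ}: Σ_{a,a' ∈ (A,2A]} (Σ_{b ≤ x/A} λ(ab+c)λ(a'b+c))² ≤
x²/(log x)^C (trivial ≍ x²; diagonal a = a' ≍ x²/A ≤ x^{2−δ}; random model ≍ xA ≤ x^{17/12}).
Equivalently tr(M_cM_cᵀ)² ≤ A²B²(log x)^{-C}, B = x/A ≥ x^{7/12}; multiplying by λ(a)λ(a'):
two-point Chowla Σ_{m ≡ 0 (aa'), m ≤ aa'B} λ(m+ac)λ(m+a'c) small on average over (a,a'). The most
informative node: implied by DilatedTableChowla (its q = 1 term; proved as an `example` in the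
planner's Sketch.lean) and the natural first target for provers and refuters. [difficulty:
open-problem] -/
@[route_item "route-Parity-LiouvilleShiftedTables"]
def TableChowla : Prop :=
  ∀ c : ℤ, c ≠ 0 → ∀ δ : ℝ, 0 < δ → δ ≤ 1 / 12 → ∀ C : ℝ, 0 < C → ∃ x₀ : ℝ, ∀ x : ℝ, x₀ ≤ x → ∀ A : ℝ, x ^ δ ≤ A → A ≤ x ^ (1 / 3 + δ) → (∑ a ∈ Finset.Ioc ⌊A⌋₊ ⌊2 * A⌋₊, ∑ a' ∈ Finset.Ioc ⌊A⌋₊ ⌊2 * A⌋₊, (∑ b ∈ Finset.Icc 1 ⌊x / A⌋₊, (ArithmeticFunction.liouville (Int.toNat ((a : ℤ) * b + c)) : ℝ) * (ArithmeticFunction.liouville (Int.toNat ((a' : ℤ) * b + c)) : ℝ)) ^ 2) ≤ x ^ 2 / Real.log x ^ C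

/-- item stmt-Parity-14271 · crux · rank 3 · open · by planner
why it might fail: Adds a sup over classes mod q and dilations up to x^{δ/2} to TableChowla: an MR-type proof must exclude multiples of exceptional q₁ ≤ (log x)^{C+2} via Siegel as BV does, no q-aspect 2-point MR theorem exists, and one structured bad class (u,v) per q breaks the sup.
sources: MatomakiRadziwillTao2015, doi:10.1112/plms.12546, Vatwani2016, Harman2007, IwaniecKowalski2004, arXiv:2109.06291
[crux] X1. For every c ≠ 0, 0 < δ ≤ 1/12, C > 0 and all large x, uniformly for x^δ ≤ A ≤ x^{1/3+δ}
and for every choice of classes u(q), v(q): Σ_{q ≤ x^{δ/2}} q³ · Σ_{a,a' ∈ (A,2A], a≡a'≡u(q) (mod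
q)} (Σ_{b ≤ x/A, b ≡ v(q) (mod q)} λ(ab+c)λ(a'b+c))² ≤ x²/(log x)^C. Normalisation: each
(q,u,v)-term is trivially ≍ x²/q⁴ (classes of a ∼ A contain no small elements since q ≤ x^{δ/2} ≤
A^{1/2}; diagonal ≍ x²/(q³A)), so the left side is trivially ≍ x² log x and the claim is a (log
x)^{C+1} saving on log-average over dilations, with a sup over classes. This is what the sieve glue
consumes: for (w,q) = 1 the class-restricted bilinear form Σ_{ab≡w (q)} α_aβ_bλ(ab+c) is
block-diagonal over u ∈ (ℤ/q)ˣ with blocks M^{(q;u,wu⁻¹)}, so |·| ≤ ‖α‖‖β‖ max_u ‖block‖_op ≤ ‖α‖‖β‖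
(max_{u,v} F(q,u,v))^{1/4}, and Hölder over q against Σ_q q³F ≤ x²/(log x)^C gives the
1/q-proportional Type-II saving that MAvg needs. Multiples of a Siegel-exceptional modulus q₁
contribute ≤ x² log x/q₁, affordable iff q₁ > (log x)^{C+2} — the ℓ¹ form is deliberately the
MR-provable one. [deps: TableChowla] [difficulty: open-problem] -/
@[route_item "route-Parity-LiouvilleShiftedTables"]
def DilatedTableChowla : Prop :=
  ∀ c : ℤ, c ≠ 0 → ∀ δ : ℝ, 0 < δ → δ ≤ 1 / 12 → ∀ C : ℝ, 0 < C → ∃ x₀ : ℝ, ∀ x : ℝ, x₀ ≤ x → ∀ A : ℝ, x ^ δ ≤ A → A ≤ x ^ (1 / 3 + δ) → ∀ u v : ℕ → ℕ, (∑ q ∈ Finset.Icc 1 ⌊x ^ (δ / 2)⌋₊, (q : ℝ) ^ 3 * ∑ a ∈ (Finset.Ioc ⌊A⌋₊ ⌊2 * A⌋₊).filter (fun a : ℕ => a ≡ u q [MOD q]), ∑ a' ∈ (Finset.Ioc ⌊A⌋₊ ⌊2 * A⌋₊).filter (fun a' : ℕ => a' ≡ u q [MOD q]), (∑ b ∈ (Finset.Icc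 1 ⌊x / A⌋₊).filter (fun b : ℕ => b ≡ v q [MOD q]), (ArithmeticFunction.liouville (Int.toNat ((a : ℤ) * b + c)) : ℝ) * (ArithmeticFunction.liouville (Int.toNat ((a' : ℤ) * b + c)) : ℝ)) ^ 2) ≤ x ^ 2 / Real.log x ^ C

/-- item stmt-Parity-14272 · crux · rank 4 · open · by planner
why it might fail: q = 1 is Fouvry–Tenenbaum Thm 1.5 (R ≤ x^{1/105}); the dilation range (log x)^B < q ≤ x^ρ carries s-dependent CRT residues mod lcm(rs,q), outside the fixed-residue dispersion of BFI Thm 9 / F–T (whose D^{C₀} loss is polynomial in q) — a new large-sieve-in-q step is needed.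
sources: FouvryTenenbaum2021, doi:10.1090/tran/8442, BombieriFriedlanderIwaniecActa1986, DrappeauTopacogullari2019, FouvryRadziwill2022, Literature.NumberTheory.Sieve.BombieriFriedlanderIwaniecTheorem5Star
[crux] X2 (Type I₂ for λ with bilinear moduli, one class constraint on the product, ℓ¹ over
dilations). For every c ≠ 0 there is ρ > 0 such that for every A and all large x, for every class w
and all 1 ≤ R ≤ x^ρ, S ≥ 0 with SR ≤ x^{1/2+ρ}, 0 ≤ y ≤ x: Σ_{q ≤ x^ρ} Σ_{r ≤ R} |Σ_{s ≤ S} Σ_{n ≤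
y/(sr), rsn ≡ w (mod q)} λ(rsn+c)| ≤ C x/(log x)^A (trivially ≍ x log³x). The inner double sum is λ
over the progression c mod rs (∩ the class w+c mod q) with the truncated-divisor multiplicity of
(m−c)/r, i.e. the Titchmarsh-divisor shape. The q = 1 slice is IN PRINT: Fouvry–Tenenbaum, Trans.
AMS 375 (2021) Thm 1.5 with f = λ ∈ 𝓕(1,1): Σ_{r ≤ x^{1/105−ε}, (r,a)=1} |Σ_{q' ≤ Q, (q',a)=1}
Δ_λ(x; q'r, a)| ≤ Cx/ℒ^A for Q·R ≤ x/ℒ^B (level 1, fixed residue a, 1 ≤ |a| ≤ ℒ^A), after removing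
the coprimality conditions (c fixed: finitely many gcd patterns) and the (1/φ)Σ_{(n,q'r)=1}λ main
terms (PNT for λ); the dilation range q ≤ (log x)^B also follows (f = λχ ∈ 𝓕(q,1), loss D^{C₀}).
Open content: (log x)^B < q ≤ x^ρ, where the residue mod lcm(rs,q) depends on s through CRT. For SR
≤ x^{1/2−ε} everything is Bombieri–Vinogradov for λ. In the glue (R,S,y) are constants (dyadic
ranges by differencing, log we -/
@[route_item "route-Parity-LiouvilleShiftedTables"]
def TypeI2Dilated : Prop :=
  ∀ c : ℤ, c ≠ 0 → ∃ ρ : ℝ, 0 < ρ ∧ ∀ A : ℝ, 0 < A → ∃ C x₀ : ℝ, ∀ x : ℝ, x₀ ≤ x → ∀ w : ℕ, ∀ R S y : ℝ, 1 ≤ R → R ≤ x ^ ρ → 0 ≤ S → S * R ≤ x ^ (1 / 2 + ρ) → 0 ≤ y → y ≤ x → (∑ q ∈ Finset.Icc 1 ⌊x ^ ρ⌋₊, ∑ r ∈ Finset.Icc 1 ⌊R⌋₊, |∑ s ∈ Finset.Icc 1 ⌊S⌋₊, ∑ n ∈ (Finset.Icc 1 ⌊y / (s * r)⌋₊).filter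 (fun n : ℕ => r * s * n ≡ w [MOD q]), (ArithmeticFunction.liouville (Int.toNat ((r : ℤ) * s * n + c)) : ℝ)|) ≤ C * x / Real.log x ^ A

/-- item stmt-Parity-14092 · crux · rank 5 · open · by planner
why it might fail: EH itself: level x^θ is open for every θ > 1/2 — the large sieve stops at Q = x^{1/2} (BFI 1986 pass it only for well-factorable weights / fixed residue), and the endpoint θ = 1 is FALSE at level x/(log x)^B (Friedlander–Granville 1989); only the x^{θ−ε} form is filed.
sources: ElliottHalberstam1970, Polymath8b2014, FriedlanderGranville1989, BombieriFriedlanderIwaniecActa1986, Literature.Barriers.Parity.LargeSieveLevelHalf, Literature.Barriers.Parity.EquidistributionLimitBarrier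
[crux] The Elliott–Halberstam conjecture BY NAME — the declared bridge premise of this CONDITIONAL
route, added as a crux by the route-choice repair (a) of 2026-08-16 (operator hold 'bridge-only':
the conditional-on constant must be one of the route's cruxes). Signature = the Literature constant
Literature.NumberTheory.Sieve.LevelOfDistribution.ElliottHalberstam = ∀ θ < 1, PrimesHaveLevel θ,
i.e. ∀ A, ε > 0: Σ_{q ≤ x^{θ−ε}} max_{1≤y≤x} max_{(a,q)=1} |ψ(y;q,a) − y/φ(q)| ≪ x(log x)^{−A}.
Definitionally equal to the verbatim node EH (stmt-Parity-11314; `Iff.rfl`, planner Sketch.lean rc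
0), which stays as the input of LevelToPairs; the deciding theorem `closes` takes THIS item (hEH :
ElliottHalberstam), so the route's dependence on the named conjecture is literal. Named open
conjecture — grounders stamp, provers/refuters do not spend effort; only θ < 1/2 is known (tree:
BombieriVinogradovStatement_holds). why it might fail: open for every θ > 1/2 and beyond the
large-sieve method (Literature.Barriers.Parity.LargeSieveLevelHalf: both terms of Q²+N−1 are
necessary, so mean-value proofs stop at Q = x^{1/2}(log x)^{−B}); the x^{θ−ε}-level, (log
x)^{−A}-saving form is the standard believed -/
@[route_item "route-Parity-LiouvilleShiftedTables"]
def ElliottHalberstam : Prop :=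
  Literature.NumberTheory.Sieve.LevelOfDistribution.ElliottHalberstam

/-- item stmt-Parity-14659 · crux · rank 6 · closed · proved by Summit.Parity.GeneralizedHardyLittlewood.Theorems.EngineToPairs.EngineToPairs_of (prover) · by planner
why it might fail: XL glue as one implication: false as stated if the Heath-Brown casework (Type-II window [X^{δ₁},X^{1/3+δ₁}], Type-I level 1/2−2δ₁, Type-I₂ box, δ₁ = ρ/4) leaves a piece uncovered for some ρ admissible in TypeI2Dilated, or if singularSeries {0,h} is not the constant Bombieri's main term yields.
sources: Heathbrown1982, Harman2007, BombieriAsymptoticSieve1976, FordMaynard2024PrimeSieves, IwaniecKowalski2004, MurtyVatwani2017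
[crux] ONE-PIECE GLUE crux (added 2026-08-16 for the crux-only `closes` rule: only crux items may be
hypotheses of the deciding theorem): the parity engine plus the bridge give Hardy–Littlewood pairs
at every fixed shift — DilatedTableChowla → TypeI2Dilated → ElliottHalberstam → PairsHL (PairsHL
signature inlined: Σ_{n≤N} Λ(n)Λ(n+h) = 𝔖({0,h})·N + o(N) for every h ≥ 1). It is EXACTLY the
composition of the two support halves kept as finer targets — SieveToMAvg (X1 ∧ X2 ∧ BVLiouville ⟹
MAvg: Heath-Brown identity, Type I from BVLiouville which is PROVED in tree
(Theorems/LiouvilleShiftedTablesBVLiouville), Type I₂ from X2, Type II from X1 via the block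
operator norms) and PairsFromMAvg (EH ∧ MAvg ⟹ pairs: Bombieri's level-1 asymptotic sieve for a_n =
Λ(n+h); EH ↔ ElliottHalberstam is Iff.rfl) — `fun hD hI hE => hP hE (hS hD hI hB)` (lean-checked):
prove those two items and compose, or prove it directly. Badged CRUX, not support, because until
proved it is a hypothesis of `closes` and because the glue can FAIL AS STATED (parameter coverage of
the sieve casework; the singular-series constant), see why-it-might-fail. [deps: SieveToMAvg,
PairsFromMAvg, BVLiouville, MAvg] [difficulty: XL] -/
@[route_item "route-Parity-LiouvilleShiftedTables"]
def EngineToPairs : Prop :=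
  DilatedTableChowla → TypeI2Dilated → ElliottHalberstam → ∀ h : ℕ, 1 ≤ h → (fun N : ℕ => ∑ n ∈ Finset.Icc 1 N, ArithmeticFunction.vonMangoldt n * ArithmeticFunction.vonMangoldt (n + h) - Literature.NumberTheory.Sieve.singularSeries ({0, (h : ℤ)} : Finset ℤ) * N) =o[Filter.atTop] fun N : ℕ => (N : ℝ)

-- `EngineToPairs` holds: proved by `Summit.Parity.GeneralizedHardyLittlewood.Theorems.EngineToPairs.EngineToPairs_of` (its module imports this route file, so no `_holds` link can be stated here).

/-- item stmt-Parity-9389 · crux · rank 9 · open · by planner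
why it might fail: An implication between open conjectures (prover verdict 2026-08-16: open-problem = GHL minus fixed-shift pairs): pairs give no leverage on k ≥ 3 tuples or general slopes; shift-uniformity |b_i| ≤ LN is Landau–Siegel-hard (Siegel zero mod q ⇒ ΣΛ(n)Λ(n+q) ≈ 2𝔖x, Matomäki–Merikoski 2023 Thm 1.3).
sources: GreenTao2010, MatomakiMerikoski2023, HardyLittlewood1923
[support] (RESIDUAL — GHL-hard, NOT addressed by this mechanism; filed so that `closes` decides the
sub-problem, D-0027 §2.1) fixed-shift Hardy–Littlewood pairs (the PairsHL statement, inlined) →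
GeneralizedHardyLittlewood (Green–Tao Conj. 1.2, all d, t, L, convex K). Contains: prime k-tuples
for every k ≥ 3 at fixed shifts (a k-fold version of the rigidity would first need 'tuple-GEH':
level 1 for (k−1)-fold products of shifted prime/rough weights); general slopes a_i n + b_i;
shift-uniformity |b_i| ≤ LN (Landau–Siegel-hard: a Siegel zero mod q forces ΣΛ(n)Λ(n+q) ≈ 2𝔖_q x,
MatomakiMerikoski2023 Thm 1.3); and the fibration d ≥ 2 ⇐ d = 1 (route DicksonFibration, provable).
True if GHL is; unprovable by anything here. [difficulty: open-problem] -/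
@[route_item "route-Parity-LiouvilleShiftedTables"]
def PairsToGHL : Prop :=
  (∀ h : ℕ, 1 ≤ h → (fun N : ℕ => ∑ n ∈ Finset.Icc 1 N, ArithmeticFunction.vonMangoldt n * ArithmeticFunction.vonMangoldt (n + h) - Literature.NumberTheory.Sieve.singularSeries ({0, (h : ℤ)} : Finset ℤ) * N) =o[Filter.atTop] fun N : ℕ => (N : ℝ)) → GeneralizedHardyLittlewood

/-- item stmt-Parity-14985 · aside · rank 1 · open · by operator
why it might fail: ElliottHalberstam is an open named conjecture; the route is only as good as it
sources: conditional_on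
the route's named condition Literature.NumberTheory.Sieve.LevelOfDistribution.ElliottHalberstam, now
a CRUX of the route (bridge-only default, 2026-08-16) -/
@[route_item "route-Parity-LiouvilleShiftedTables"]
def ElliottHalberstamCond : Prop :=
  _root_.Literature.NumberTheory.Sieve.LevelOfDistribution.ElliottHalberstam

/-- item stmt-Parity-11314 · aside (kind.auto-crux: conjecture-grade) · rank 9 · open · by planner
why it might fail: EH itself: level x^θ is open for every θ > 1/2 — large-sieve/mean-value proofs stop at Q = x^{1/2}(log x)^{-B} (BFI 1986 pass it only for well-factorable weights / fixed residue), and the endpoint θ = 1 is FALSE at level x/(log x)^B (Friedlander–Granville 1989).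
sources: ElliottHalberstam1970, Polymath8b2014, FriedlanderGranville1989, BombieriFriedlanderIwaniecActa1986, Literature.Barriers.Parity.LargeSieveLevelHalf
[support] The Elliott–Halberstam conjecture, spelled out verbatim over Mathlib (∀ θ < 1, ∀ A, ε > 0:
Σ_{q ≤ x^{θ−ε}} max_{1≤y≤x} max_{(a,q)=1} |ψ(y;q,a) − y/φ(q)| ≪ x (log x)^{−A}; `Iff.rfl` with
Literature.NumberTheory.Sieve.LevelOfDistribution.ElliottHalberstam — cone repair 2026-08-15), the
bridge hypothesis X₀, listed as an item so that the deciding theorem `closes` assumes only route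
decls (D-0027 §2.1). Named open conjecture: grounders stamp, provers/refuters should not spend
effort. [difficulty: open-problem] -/
@[route_item "route-Parity-LiouvilleShiftedTables"]
def EH : Prop :=
  ∀ θ : ℝ, θ < 1 → ∀ A : ℝ, 0 < A → ∀ ε : ℝ, 0 < ε → (fun x : ℝ => ∑ q ∈ Finset.Icc 1 ⌊x ^ (θ - ε)⌋₊, ⨆ y : ↥(Set.Icc (1 : ℝ) x), ⨆ a : (ZMod q)ˣ, |(∑ n ∈ Finset.range (⌊(y : ℝ)⌋₊ + 1), ArithmeticFunction.vonMangoldt.residueClass (a : ZMod q) n) - (y : ℝ) / (Nat.totient q : ℝ)|) =O[Filter.atTop] fun x : ℝ => x / Real.log x ^ A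

/-- item stmt-Parity-13324 · support · rank 9 · closed · proved by Summit.Parity.GeneralizedHardyLittlewood.Cruxes.TypeI2Dilated.PeelToDrappeau.stub_bvLiouville @ 728982fbd7eb (prover) · by planner
sources: FouvryTenenbaum2021, IwaniecKowalski2004, Vaughan1980, BombieriFriedlanderIwaniecActa1986
[support] Bombieri–Vinogradov for λ at level x^{1/2−ε} with absolute values, one arbitrary residue
c_d ∈ [0,d) and one height y_d ≤ x per modulus d ≥ 1 (= retired stmt-Parity-8057 verbatim):
Σ_{d≤x^{1/2−ε}} |Σ_{n≤y_d/d} λ(dn+c_d)| ≤ Cx/(log x)^A. Known theorem, not yet a named fact: classes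
with g = (c_d,d) > 1 reduce to coprime classes mod d/g at scale x/g (complete multiplicativity),
then λ = Σ_{k²d=n} μ(d) + Heath-Brown's identity (tree: heathBrown_identity) + BFI Theorem 0(b)
(tree, PROVED: BombieriFriedlanderIwaniecTheorem0b_holds) + Siegel–Walfisz for μ/λ (tree, PROVED:
SiegelWalfiszMoebius_holds, .liouville_progression); d = 1 is the PNT for λ. The ∀-choice-function
form implies the max form used downstream. [difficulty: L] -/
@[route_item "route-Parity-LiouvilleShiftedTables"]
def BVLiouville : Prop :=
  ∀ ε : ℝ, 0 < ε → ∀ A : ℝ, 0 < A → ∃ C x₀ : ℝ, ∀ x : ℝ, x₀ ≤ x → ∀ c : ℕ → ℤ, ∀ y : ℕ → ℝ, (∀ d, 1 ≤ d → 0 ≤ c d ∧ c d < d) → (∀ d, 0 ≤ y d ∧ y d ≤ x) → (∑ d ∈ Finset.Icc 1 ⌊x ^ (1 / 2 - ε)⌋₊, |∑ n ∈ Finset.Icc 1 ⌊y d / d⌋₊, (ArithmeticFunction.liouville (Int.toNat ((d : ℤ) * n + c d)) : ℝ)|) ≤ C * x / Real.log x ^ A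

-- `BVLiouville` holds: proved by `Summit.Parity.GeneralizedHardyLittlewood.Cruxes.TypeI2Dilated.PeelToDrappeau.stub_bvLiouville` @ 728982fbd7eb (its module imports this route file, so no `_holds` link can be stated here).

/-- item stmt-Parity-14273 · support · rank 9 · open · by planner
sources: BombieriAsymptoticSieve1976, Harman2007, Vatwani2016, MurtyVatwani2017, Lichtman2020
[support] Terminal parity node, identical to stmt-Parity-0613
(MobiusShiftedPrimes.MobiusDilatedShiftedPrimesAvg, shared by signature): for every h ≥ 1 there is ε
> 0 with Σ_{m ≤ x^ε} log m · |Σ_{d ≤ x/m} μ(d)Λ(dm+h)| = o(x) — Bombieri's level-1 asymptotic-sieve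
residual for a_n = Λ(n+h) (trivial ≍ ε²x(log x)²/2, so a uniform (log x)^{2+δ}/m saving over
dilations m ≤ x^ε is needed). This route does not attack it directly; SieveToMAvg delivers it from
X1 ∧ X2 ∧ BVLiouville. Filed so that a direct proof or refutation of 0613 moves this route too.
[difficulty: open-problem] -/
@[route_item "route-Parity-LiouvilleShiftedTables"]
def MAvg : Prop :=
  ∀ h : ℕ, 1 ≤ h → ∃ ε : ℝ, 0 < ε ∧ (fun x : ℝ => ∑ m ∈ Finset.Icc 1 ⌊x ^ ε⌋₊, Real.log m * |∑ d ∈ Finset.Icc 1 ⌊x / m⌋₊, (ArithmeticFunction.moebius d : ℝ) * ArithmeticFunction.vonMangoldt (d * m + h)|) =o[Filter.atTop] fun x : ℝ => x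

/-- item stmt-Parity-14274 · support · rank 9 · closed · proved by Summit.Parity.GeneralizedHardyLittlewood.Theorems.SieveToMAvg.SieveToMAvg_proof (prover) · by planner
sources: Heathbrown1982, Harman2007, BombieriFriedlanderIwaniecActa1986, FordMaynard2024PrimeSieves, IwaniecKowalski2004
[support] The sieve glue (sizable but standard): DilatedTableChowla → TypeI2Dilated → BVLiouville →
MAvg. Proof plan (details NOTES.md): fix h, c := −h, ρ from X2 (shrink to ρ ≤ 1/4; X2 is monotone in
ρ), δ₁ := ρ/4, ε := δ₁/8. (i) μ(d) = λ(d)Σ_{k²∣d}μ(k) and λ((p−h)/q) = λ(q)λ(p−h) give Σ_{d≤x/m}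
μ(d)Λ(dm+h) = Σ_{k≤K} μ(k)λ(k²m)·T(x+h; k²m, h) + O(x log x/(mK) + √(x/m) log x), T(X;q,h) :=
Σ_{h<n≤X, n≡h (q)} Λ(n)λ(n−h), K = (log x)⁴, ALL at the single height x+h; for fixed k the map m ↦
k²m is injective, so Σ_{m≤x^ε} log m |S_m| ≤ ε log x · K · Σ_{q ≤ x^{2ε}} |T(x+h;q,h)| + o(x), and
it suffices that Σ_{q≤X^{2ε}} |T(X;q,h)| ≪ X/(log X)^6 ((h,q) > 1 classes hold O(log X) prime
powers). (ii) Heath-Brown's identity with K₀ = 3 on Λ (in tree), dyadic boxes, classification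
uniform in q: a sub-product in [X^{δ₁}, X^{1/3+δ₁}] ∪ [X^{2/3−δ₁}, X^{1−δ₁}] ⇒ Type II; else smalls
have product r < X^{δ₁} and exactly two smooth variables exceed X^{1/3}: one ≥ X^{1/2+2δ₁} ⇒ Type I,
else both in (X^{1/2−3δ₁}, X^{1/2+2δ₁}] ⇒ Type I₂; pieces with n ≤ X^{1−δ₁/10} trivially. (iii) Type
II: remove ab ≤ X' by (1+(log X)^{-C'})-subdivision of the a-range (boundary entries summed over q
via #{q : q ∣ n−h} ≤ -/
@[route_item "route-Parity-LiouvilleShiftedTables"]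
def SieveToMAvg : Prop :=
  DilatedTableChowla → TypeI2Dilated → BVLiouville → MAvg

-- `SieveToMAvg` holds: proved by `Summit.Parity.GeneralizedHardyLittlewood.Theorems.SieveToMAvg.SieveToMAvg_proof` (its module imports this route file, so no `_holds` link can be stated here).

/-- item stmt-Parity-14275 · support · rank 9 · closed · proved by Summit.Parity.GeneralizedHardyLittlewood.Theorems.PairsFromMAvg_proof (prover) · by planner
sources: BombieriAsymptoticSieve1976, Bombieri1976, MurtyVatwani2017, Vatwani2016, HardyLittlewood1923
[support] Bombieri's asymptotic sieve at level 1 for a_n = Λ(n+h), all shifts (provable bookkeeping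
given the two hypotheses): EH → MAvg → PairsHL (conclusion = the PairsHL signature verbatim). Plan:
Σ_{n≤N}Λ(n)Λ(n+h) = Σ_{dm≤N} μ(d) log m Λ(dm+h) (Λ = μ ∗ log); the part m ≤ N^{ε₀} (ε₀ from MAvg(h)
at x = N) is bounded by the MAvg expression = o(N); for m > N^{ε₀} one has d < N^{1−ε₀} and
Σ_{N^{ε₀}<m≤N/d} log m Λ(dm+h) = (d/φ(d))∫_{N^{ε₀}}^{N/d} log t dt + E_d for (d,h)=1 ((d,h)>1:
O(log²N)), with Σ_d |E_d| ≪ log N · Σ_{d<N^{1−ε₀}} max_{y≤2N}|ψ(y;d,h) − y/φ(d)| ≪ N(log N)^{1−A} by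
EH at θ = 1−ε₀/2; main term N·Σ_{d<N^{1−ε₀},(d,h)=1} μ(d)(log N − 1 − log d)/φ(d) − N^{ε₀}(ε₀ log N
− 1)Σ_d μ(d)d/φ(d)·1_{(d,h)=1} = 𝔖({0,h})N + O(N(log N)^{1−A}) using Σ_{(d,h)=1} μ(d)/φ(d) = 0,
−Σ_{(d,h)=1} μ(d) log d/φ(d) = 𝔖({0,h}) (F_h(s) = Σ μ(d)/(φ(d)d^s) = s·G_h(s), G_h(0) =
(h/φ(h))Π_{p∤h}(1−1/(p−1)²) = singularSeries {0,h}, = 0 for odd h) with PNT-strength tails, and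
Σ_{d<D} μ(d)d/φ(d) ≪ D(log D)^{-A}. Needs the ordered Euler product
Literature.NumberTheory.Sieve.singularSeries (limUnder) identified with G_h(0). [difficulty: L] -/
@[route_item "route-Parity-LiouvilleShiftedTables"]
def PairsFromMAvg : Prop :=
  EH → MAvg → ∀ h : ℕ, 1 ≤ h → (fun N : ℕ => ∑ n ∈ Finset.Icc 1 N, ArithmeticFunction.vonMangoldt n * ArithmeticFunction.vonMangoldt (n + h) - Literature.NumberTheory.Sieve.singularSeries ({0, (h : ℤ)} : Finset ℤ) * N) =o[Filter.atTop] fun N : ℕ => (N : ℝ)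

-- `PairsFromMAvg` holds: proved by `Summit.Parity.GeneralizedHardyLittlewood.Theorems.PairsFromMAvg_proof` (its module imports this route file, so no `_holds` link can be stated here).

/-- item stmt-Parity-14839 · support · rank 9 · open · by planner
sources: MatomakiRadziwillTao2015, doi:10.1112/plms.12546, Vatwani2016, IwaniecKowalski2004, arXiv:2109.06291
[support] LARGE-DILATION BAND of X1 (= the layer-2 piece `GenericDilations` foreseen in the
TWO-LAYER PLAN, filed 2026-08-16 by the unused-crux repair so that the rank-2 crux TableChowla feeds
`closes`): for every c ≠ 0, 0 < δ ≤ 1/12 and C > 0 there are K and x₀ such that for x ≥ x₀,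
uniformly for x^δ ≤ A ≤ x^{1/3+δ} and every choice of classes u(q), v(q): Σ_{(log x)^K < q ≤
x^{δ/2}} q³ · Σ_{a,a' ∈ (A,2A], a≡a'≡u(q) (mod q)} (Σ_{b ≤ x/A, b≡v(q) (mod q)} λ(ab+c)λ(a'b+c))² ≤
x²/(log x)^C — i.e. DilatedTableChowla with the Siegel range q ≤ (log x)^K removed, the threshold
exponent K = K(c,δ,C) being free (∃ K is the weakest form the glue TableToDilated accepts: a band
bound Σ_{q∼Q} q³F ≪ x²·Q^{-η} takes K = ⌈(C+1)/η⌉; a larger K only drops non-negative terms). Each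
(q,u,v)-term is trivially ≍ x²/q⁴, so this is a (log x)^{C+1} saving on ℓ¹/log-average over the
dilations q > (log x)^K with a sup over classes: the genuinely q-ASPECT content of X1 (large sieve /
dispersion in q, Matomäki–Radziwiłł in progressions à la KMT doi:10.1112/plms.12546), every q ≤ (log
x)^K — exceptional or not — being paid for by TableChowla through positivity. Implied by
DilatedTableChowla (sub-sum of non-negat -/
@[route_item "route-Parity-LiouvilleShiftedTables"]
def LargeDilatedTableChowla : Prop :=
  ∀ c : ℤ, c ≠ 0 → ∀ δ : ℝ, 0 < δ → δ ≤ 1 / 12 → ∀ C : ℝ, 0 < C → ∃ K : ℕ, ∃ x₀ : ℝ, ∀ x : ℝ, x₀ ≤ x → ∀ A : ℝ, x ^ δ ≤ A → A ≤ x ^ (1 / 3 + δ) → ∀ u v : ℕ → ℕ, (∑ q ∈ Finset.Ioc ⌊Real.log x ^ K⌋₊ ⌊x ^ (δ / 2)⌋₊, (q : ℝ) ^ 3 * ∑ a ∈ (Finset.Ioc ⌊A⌋₊ ⌊2 * A⌋₊).filter (fun a : ℕ => a ≡ u q [MOD q]), ∑ a' ∈ (Finset.Ioc ⌊A⌋₊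 ⌊2 * A⌋₊).filter (fun a' : ℕ => a' ≡ u q [MOD q]), (∑ b ∈ (Finset.Icc 1 ⌊x / A⌋₊).filter (fun b : ℕ => b ≡ v q [MOD q]), (ArithmeticFunction.liouville (Int.toNat ((a : ℤ) * b + c)) : ℝ) * (ArithmeticFunction.liouville (Int.toNat ((a' : ℤ) * b + c)) : ℝ)) ^ 2) ≤ x ^ 2 / Real.log x ^ C

/-- item stmt-Parity-14840 · support · rank 9 · closed · proved by Summit.Parity.GeneralizedHardyLittlewood.Theorems.tableToDilated_proof (prover) · by planner
sources: Harman2007, IwaniecKowalski2004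
[support] GLUE (unused-crux repair 2026-08-16; provable NOW — positivity plus splitting the q-sum):
TableChowla → LargeDilatedTableChowla → DilatedTableChowla, which makes the rank-2 crux TableChowla
feed the `closes` hypothesis DilatedTableChowla. Proof (one page). (1) POSITIVITY — the Siegel range
is free: write m_{ab} := λ(ab+c) ∈ {0,±1} and F(U,V) := Σ_{a,a'∈U} (Σ_{b∈V} m_{ab} m_{a'b})² for
subsets U ⊆ (A,2A], V ⊆ [1,x/A] (in particular the classes a ≡ u(q), b ≡ v(q) of the (q,u,v)-term).
Expanding the square, F(U,V) = Σ_{a,a'∈U} Σ_{b,b'∈V} m_{ab}m_{a'b}m_{ab'}m_{a'b'} = Σ_{b,b'∈V}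
(Σ_{a∈U} m_{ab}m_{ab'})², so F is a sum of non-negative squares indexed by U×U (V fixed) and by V×V
(U fixed); dropping terms twice, F(U,V) ≤ F(all,V) ≤ F(all,all) = T(x,A,c), the TableChowla double
sum (equivalently: the Schatten-4 norm of the sub-block P_U M_c P_V is at most that of M_c). Hence
for every K and every choice u, v: Σ_{q ≤ (log x)^K} q³ F(q,u(q),v(q)) ≤ ⌊(log x)^K⌋₊·(log x)^{3K}·T
≤ (log x)^{4K}·T. (2) SPLIT: given (c,δ,C) take K, x₁ from LargeDilatedTableChowla at exponent C+1
and x₂ from TableChowla at exponent C+1+4K; for x ≥ max(x₁, x₂, e²) and A in the window, split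
Finset.Icc 1 ⌊ -/
@[route_item "route-Parity-LiouvilleShiftedTables"]
def TableToDilated : Prop :=
  TableChowla → LargeDilatedTableChowla → DilatedTableChowla

-- `TableToDilated` holds: proved by `Summit.Parity.GeneralizedHardyLittlewood.Theorems.tableToDilated_proof` (its module imports this route file, so no `_holds` link can be stated here).

/-- item stmt-Parity-9387 · support · rank 9 · open · by planner
sources: HardyLittlewood1923, GreenTao2010
[support] Hardy–Littlewood pairs, Λ-form, fixed shift: for every h ≥ 1, Σ_{n≤N} Λ(n)Λ(n+h) =
𝔖({0,h})·N + o(N). Verbatim the signature of TauberianTwins.PairsHL (stmt-Parity-0867): the terminal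
statement of this bridge (k-tuples and shift-uniform GHL are NOT claimed; see route DicksonFibration
for PairsHL → DimOne → GHL). [difficulty: open-problem] -/
@[route_item "route-Parity-LiouvilleShiftedTables"]
def PairsHL : Prop :=
  ∀ h : ℕ, 1 ≤ h → (fun N : ℕ => ∑ n ∈ Finset.Icc 1 N, ArithmeticFunction.vonMangoldt n * ArithmeticFunction.vonMangoldt (n + h) - Literature.NumberTheory.Sieve.singularSeries ({0, (h : ℤ)} : Finset ℤ) * N) =o[Filter.atTop] fun N : ℕ => (N : ℝ)

-- earlier Assembly (stmt-Parity-14276, replaced 2026-08-16T04:26:53Z -> stmt-Parity-14669): retired by None — DilatedTableChowla → TypeI2Dilated → BVLiouville → SieveToMAvg → EH → PairsFromMAvg → PairsToGHL → GeneralizedHardyLittlewood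
/-- item stmt-Parity-14669 · assembly · rank 1 · closed · proved by Summit.Parity.GeneralizedHardyLittlewood.Theorems.liouvilleShiftedTablesAssembly_proof @ 11c416cd9f35 (prover) · by planner
sources: Harman2007, Heathbrown1982, BombieriAsymptoticSieve1976, GreenTao2010
[assembly] DilatedTableChowla → TypeI2Dilated → ElliottHalberstam → EngineToPairs → PairsToGHL →
GeneralizedHardyLittlewood — the type of the crux-only deciding theorem `closes` (re-certified
2026-08-16, rev 9: `closes hD hI hE hX hG := hG (hX hD hI hE)`); restated from the rev-4 chain
DilatedTableChowla → TypeI2Dilated → BVLiouville → SieveToMAvg → EH → PairsFromMAvg → PairsToGHL →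
GHL, whose support hypotheses are now folded into the crux EngineToPairs (BVLiouville proved;
SieveToMAvg, PairsFromMAvg kept as support halves). -/
@[route_item "route-Parity-LiouvilleShiftedTables"]
def Assembly : Prop :=
  DilatedTableChowla → TypeI2Dilated → ElliottHalberstam → EngineToPairs → PairsToGHL → GeneralizedHardyLittlewood

-- `Assembly` holds: proved by `Summit.Parity.GeneralizedHardyLittlewood.Theorems.liouvilleShiftedTablesAssembly_proof` @ 11c416cd9f35 (its module imports this route file, so no `_holds` link can be stated here).

/-! D-0027 §2.1 — DECIDING THEOREM (planner-authored via `route open/edit --closes-file`; by planner-rrepair-Parity-LiouvilleShiftedTables--127ed6e4-0 2026-08-16T06:33:55Z):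
its hypotheses are this route's items and its conclusion the sub-problem Statement (glue_lint), and it elaborates with this file. -/

/-- D-0027 §2.1 deciding theorem of route LiouvilleShiftedTables, CRUX-ONLY form (2026-08-16: only crux items may be
hypotheses of `closes`). CONDITIONAL BRIDGE on the crux `ElliottHalberstam` (= the conditional_on constant
`Literature.NumberTheory.Sieve.LevelOfDistribution.ElliottHalberstam` by name); the GHL-beyond-pairs sector is the crux
`PairsToGHL`. The engine cruxes `DilatedTableChowla ∧ TypeI2Dilated` and the bridge feed the one-piece glue crux
`EngineToPairs` (= the composition of the support halves `SieveToMAvg` and `PairsFromMAvg` with the PROVED `BVLiouville`: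
`fun hD hI hE => hP hE (hS hD hI hB)`), which yields Hardy–Littlewood pairs at every fixed shift; `PairsToGHL` carries
pairs to the sub-problem Statement. The rank-2 crux `TableChowla` is not a hypothesis but FEEDS `hD` through the support
glue `TableToDilated : TableChowla → LargeDilatedTableChowla → DilatedTableChowla` (unused-crux repair 2026-08-16: the
q = 1 table dominates every dilation q ≤ (log x)^K by positivity; `LargeDilatedTableChowla` is the remaining band).
`EH`, `BVLiouville`, `MAvg`, `SieveToMAvg`, `PairsFromMAvg`, `PairsHL`, `LargeDilatedTableChowla`, `TableToDilated`
and `Assembly` are items but not hypotheses. Pure logic. -/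
@[closes "route-Parity-LiouvilleShiftedTables"] theorem closes (hD : DilatedTableChowla) (hI : TypeI2Dilated) (hE : ElliottHalberstam)
    (hX : EngineToPairs) (hG : PairsToGHL) : _root_.GeneralizedHardyLittlewood :=
  hG (hX hD hI hE)

end Summit.Parity.GeneralizedHardyLittlewood.Theses.LiouvilleShiftedTables
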